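import Mathlib.Analysis.SpecialFunctions.Log.Basic
import Mathlib.MeasureTheory.Integral.DominatedConvergence
import Mathlib.MeasureTheory.Integral.IntervalIntegral.Basic
import Mathlib.Topology.UniformSpace.HeineCantor
import HarnessLib

/-!
# Telescoped logarithms of step ratios and Riemann sums

Topic `Literature/Analysis/Asymptotics`, namespace `Literature.Analysis.Asymptotics`.
The calculus behind "integration of logarithmic derivatives along a lattice path"
(Chelkak–Hongler–Izyurov 2015, §2.8, proof of Prop. 2.20): if along a lattice path `v₀, …, v_N`,
`N δ = O(1)`, the step ratios satisfy `q_m = E(v_{m+1})/E(v_m) = 1 + δ (g_m + o(1))` uniformly in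
`m`, with `g_m` bounded, then

  `log E(v_N) - log E(v_0) = ∑_m log q_m = δ ∑_m g_m + o(1)`

(`sum_range_log_div`, `tendsto_sum_log_sub_mul_sum`), and the Riemann sums `h ∑_{m<N} f(m h)` of a
continuous `f` converge to `∫_0^T f` when `h → 0⁺`, `N h → T` (`tendsto_mul_sum_range_intervalIntegral`).

## Main statements

* `abs_log_one_add_sub_le` — `|log(1+y) - y| ≤ 2y²` for `|y| ≤ 1/2`;
* `sum_range_log_div` — telescoping;
* `tendsto_sum_log_sub_mul_sum` — `∑ log q_m - δ ∑ g_m → 0`;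
* `tendsto_mul_sum_range_intervalIntegral` — convergence of left Riemann sums of a continuous
  function with mesh `h → 0⁺` and `N h → T`.

## References

* D. Chelkak, C. Hongler, K. Izyurov, Ann. of Math. 181 (2015), §2.8, proof of Prop. 2.20
  [ChelkakHonglerIzyurovAnnals2015].
* W. Rudin, *Principles of Mathematical Analysis*, 3rd ed., Thm. 6.8 and 6.20 (Riemann sums of
  continuous functions; the primitive is continuous) [folklore].
-/

noncomputable section

open Filter Set Finset MeasureTheory intervalIntegral
open scoped Topology

namespace Literature.Analysis.Asymptotics

/-! ### `log (1 + y) = y + O(y²)` -/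

/-- **`|log(1+y) - y| ≤ 2 y²` for `|y| ≤ 1/2`**, from `1 - 1/x ≤ log x ≤ x - 1`. [folklore] -/
theorem abs_log_one_add_sub_le {y : ℝ} (hy : |y| ≤ 1 / 2) : |Real.log (1 + y) - y| ≤ 2 * y ^ 2 := by
  have hy1 : -(1 / 2) ≤ y := (abs_le.1 hy).1
  have hpos : 0 < 1 + y := by linarith
  have h1 : Real.log (1 + y) ≤ y := by
    have := Real.log_le_sub_one_of_pos hpos; linarith
  have h2 : 1 - (1 + y)⁻¹ ≤ Real.log (1 + y) := Real.one_sub_inv_le_log_of_pos hpos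
  have h3 : y - 2 * y ^ 2 ≤ 1 - (1 + y)⁻¹ := by
    have : (1 + y)⁻¹ ≤ 1 - y + 2 * y ^ 2 := by
      rw [inv_eq_one_div, div_le_iff₀ hpos]
      nlinarith [sq_nonneg y, hy1]
    linarith
  rw [abs_le]
  constructor <;> linarith

/-! ### Telescoping -/

/-- `∑_{m<N} log (x_{m+1}/x_m) = log x_N - log x_0` for positive `x_m`. [folklore] -/
theorem sum_range_log_div {x : ℕ → ℝ} {N : ℕ} (hx : ∀ m ≤ N, 0 < x m) :
    ∑ m ∈ range N, Real.log (x (m + 1) / x m) = Real.log (x N) - Real.log (x 0) := by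
  have h : ∀ m < N, Real.log (x (m + 1) / x m) = Real.log (x (m + 1)) - Real.log (x m) :=
    fun m hm => Real.log_div (hx (m + 1) hm).ne' (hx m hm.le).ne'
  rw [Finset.sum_congr rfl fun m hm => h m (Finset.mem_range.1 hm)]
  exact Finset.sum_range_sub (fun m => Real.log (x m)) N

/-! ### `∑ log q_m = δ ∑ g_m + o(1)` -/

/-- **Telescoped logarithms of step ratios.** Along `𝓝[>] 0`, let `N δ ∈ ℕ` with `N δ · δ ≤ C`,
bounded slopes `|g δ m| ≤ M` (`m < N δ`), and step ratios `q δ m` with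
`|(q δ m - 1)/δ - g δ m| ≤ ε` for all `m < N δ`, eventually, for every `ε > 0`. Then
`∑_{m<N δ} log (q δ m) - δ ∑_{m<N δ} g δ m → 0`. [cite: ChelkakHonglerIzyurovAnnals2015, §2.8, proof of Prop. 2.20] -/
theorem tendsto_sum_log_sub_mul_sum {N : ℝ → ℕ} {q g : ℝ → ℕ → ℝ} {C M : ℝ}
    (hN : ∀ᶠ δ in 𝓝[>] (0 : ℝ), (N δ : ℝ) * δ ≤ C)
    (hg : ∀ᶠ δ in 𝓝[>] (0 : ℝ), ∀ m < N δ, |g δ m| ≤ M)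
    (hq : ∀ ε : ℝ, 0 < ε → ∀ᶠ δ in 𝓝[>] (0 : ℝ), ∀ m < N δ, |(q δ m - 1) / δ - g δ m| ≤ ε) :
    Tendsto (fun δ => ∑ m ∈ range (N δ), Real.log (q δ m) - δ * ∑ m ∈ range (N δ), g δ m)
      (𝓝[>] 0) (𝓝 0) := by
  have hC : 0 ≤ C ∨ ∀ᶠ δ in 𝓝[>] (0 : ℝ), False := by
    by_cases h : 0 ≤ C
    · exact Or.inl h
    · right
      filter_upwards [hN, self_mem_nhdsWithin] with δ hδ hδ0
      have : (0 : ℝ) ≤ N δ * δ := mul_nonneg (Nat.cast_nonneg _) (le_of_lt hδ0)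
      exact h (this.trans hδ)
  rw [Metric.tendsto_nhds]
  intro ε' hε'
  rcases hC with hC | hfalse
  swap
  · filter_upwards [hfalse] with δ h using h.elim
  have hM : 0 ≤ M ∨ ∀ᶠ δ in 𝓝[>] (0 : ℝ), N δ = 0 := by
    by_cases h : 0 ≤ M
    · exact Or.inl h
    · right
      filter_upwards [hg] with δ hδ
      by_contra hN0
      have := hδ 0 (Nat.pos_of_ne_zero hN0)
      exact h ((abs_nonneg _).trans this)
  -- choose ε with (C + 1) ε ≤ ε'/2, then δ small
  set ε : ℝ := ε' / (2 * (C + 1)) with hε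
  have hεpos : 0 < ε := by positivity
  set M' : ℝ := max M 0 with hM'
  have hM'0 : 0 ≤ M' := le_max_right _ _
  have hδsmall : ∀ᶠ δ in 𝓝[>] (0 : ℝ), δ * (M' + ε) ≤ 1 / 2 ∧ 2 * (C + 1) * δ * (M' + ε) ^ 2 ≤ ε' / 4 := by
    have h1 : Tendsto (fun δ : ℝ => δ * (M' + ε)) (𝓝[>] 0) (𝓝 0) := by
      have : Tendsto (fun δ : ℝ => δ * (M' + ε)) (𝓝 0) (𝓝 (0 * (M' + ε))) :=
        tendsto_id.mul_const _
      rw [zero_mul] at this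
      exact this.mono_left nhdsWithin_le_nhds
    have h2 : Tendsto (fun δ : ℝ => 2 * (C + 1) * δ * (M' + ε) ^ 2) (𝓝[>] 0) (𝓝 0) := by
      have : Tendsto (fun δ : ℝ => 2 * (C + 1) * δ * (M' + ε) ^ 2) (𝓝 0)
          (𝓝 (2 * (C + 1) * 0 * (M' + ε) ^ 2)) :=
        ((tendsto_id.const_mul _).mul_const _)
      rw [mul_zero, zero_mul] at this
      exact this.mono_left nhdsWithin_le_nhds
    filter_upwards [h1.eventually (ge_mem_nhds (by norm_num : (0 : ℝ) < 1 / 2)),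
      h2.eventually (ge_mem_nhds (by positivity : (0 : ℝ) < ε' / 4))] with δ hδ1 hδ2
    exact ⟨hδ1, hδ2⟩
  filter_upwards [hN, hg, hq ε hεpos, hδsmall, self_mem_nhdsWithin] with δ hNδ hgδ hqδ ⟨hδ1, hδ2⟩ hδ0
  rw [Real.dist_eq, sub_zero]
  have hδpos : (0 : ℝ) < δ := hδ0
  -- termwise bound
  have hterm : ∀ m < N δ, |Real.log (q δ m) - δ * g δ m| ≤ 2 * (δ * (M' + ε)) ^ 2 + δ * ε := by
    intro m hm
    have hgm : |g δ m| ≤ M' := (hgδ m hm).trans (le_max_left _ _)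
    have hqm := hqδ m hm
    set y := q δ m - 1 with hy
    have hy' : |y - δ * g δ m| ≤ δ * ε := by
      have : y - δ * g δ m = δ * ((q δ m - 1) / δ - g δ m) := by
        rw [hy]; field_simp
      rw [this, abs_mul, abs_of_pos hδpos]
      exact mul_le_mul_of_nonneg_left hqm hδpos.le
    have hyabs : |y| ≤ δ * (M' + ε) := by
      calc |y| = |(y - δ * g δ m) + δ * g δ m| := by ring_nf
        _ ≤ |y - δ * g δ m| + |δ * g δ m| := abs_add_le _ _
        _ ≤ δ * ε + δ * M' := by
            rw [abs_mul, abs_of_pos hδpos]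
            exact add_le_add hy' (mul_le_mul_of_nonneg_left hgm hδpos.le)
        _ = δ * (M' + ε) := by ring
    have hlog := abs_log_one_add_sub_le (hyabs.trans hδ1)
    have hq1 : q δ m = 1 + y := by rw [hy]; ring
    rw [hq1]
    calc |Real.log (1 + y) - δ * g δ m| = |(Real.log (1 + y) - y) + (y - δ * g δ m)| := by ring_nf
      _ ≤ |Real.log (1 + y) - y| + |y - δ * g δ m| := abs_add_le _ _
      _ ≤ 2 * y ^ 2 + δ * ε := add_le_add hlog hy'
      _ ≤ 2 * (δ * (M' + ε)) ^ 2 + δ * ε := by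
          have : y ^ 2 ≤ (δ * (M' + ε)) ^ 2 := by
            rw [← sq_abs y]
            exact pow_le_pow_left₀ (abs_nonneg y) hyabs 2
          linarith
  -- sum the bounds
  rw [Finset.mul_sum, ← Finset.sum_sub_distrib]
  calc |∑ m ∈ range (N δ), (Real.log (q δ m) - δ * g δ m)|
      ≤ ∑ m ∈ range (N δ), |Real.log (q δ m) - δ * g δ m| := Finset.abs_sum_le_sum_abs _ _
    _ ≤ ∑ _m ∈ range (N δ), (2 * (δ * (M' + ε)) ^ 2 + δ * ε) :=
        Finset.sum_le_sum fun m hm => hterm m (Finset.mem_range.1 hm)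
    _ = (N δ : ℝ) * δ * (2 * δ * (M' + ε) ^ 2 + ε) := by
        rw [Finset.sum_const, Finset.card_range, nsmul_eq_mul]; ring
    _ ≤ C * (2 * δ * (M' + ε) ^ 2 + ε) := by
        apply mul_le_mul_of_nonneg_right hNδ
        positivity
    _ < ε' := by
        have h1 : C * ε ≤ ε' / 2 := by
          rw [hε]
          rw [mul_div_assoc']
          rw [div_le_div_iff₀ (by positivity) (by norm_num)]
          nlinarith
        have h2 : C * (2 * δ * (M' + ε) ^ 2) ≤ ε' / 4 := by
          calc C * (2 * δ * (M' + ε) ^ 2) ≤ (C + 1) * (2 * δ * (M' + ε) ^ 2) := by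
                apply mul_le_mul_of_nonneg_right (by linarith); positivity
            _ = 2 * (C + 1) * δ * (M' + ε) ^ 2 := by ring
            _ ≤ ε' / 4 := hδ2
        nlinarith

/-! ### Riemann sums of a continuous function -/

/-- **Left Riemann sums of a continuous function**: along a filter `l`, if `h → 0⁺` and
`N · h → T` (`T ≥ 0`), then `h ∑_{m < N} f(m h) → ∫_0^T f` for `f : ℝ → ℝ` continuous (uniform
continuity on `[0, T+1]` and continuity of the primitive). [folklore] -/
theorem tendsto_mul_sum_range_intervalIntegral {ι : Type*} {l : Filter ι} {f : ℝ → ℝ}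
    (hf : Continuous f) {h : ι → ℝ} {N : ι → ℕ} {T : ℝ} (hT : 0 ≤ T)
    (hh : Tendsto h l (𝓝[>] 0)) (hNh : Tendsto (fun i => (N i : ℝ) * h i) l (𝓝 T)) :
    Tendsto (fun i => h i * ∑ m ∈ range (N i), f (m * h i)) l (𝓝 (∫ s in (0 : ℝ)..T, f s)) := by
  have hint : ∀ a b : ℝ, IntervalIntegrable f volume a b := fun a b =>
    hf.intervalIntegrable a b
  -- Step 1: `∫_0^{N h} f → ∫_0^T f`
  have hprim : Tendsto (fun i => ∫ s in (0 : ℝ)..((N i : ℝ) * h i), f s) l (𝓝 (∫ s in (0 : ℝ)..T, f s)) :=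
    ((continuous_primitive hint 0).tendsto T).comp hNh
  -- Step 2: the Riemann sum minus `∫_0^{N h} f` tends to `0`
  have hdiff : Tendsto (fun i => h i * ∑ m ∈ range (N i), f (m * h i) -
      ∫ s in (0 : ℝ)..((N i : ℝ) * h i), f s) l (𝓝 0) := by
    rw [Metric.tendsto_nhds]
    intro ε hε
    -- uniform continuity of `f` on `[0, T + 1]`
    have huc : UniformContinuousOn f (Icc 0 (T + 1)) :=
      isCompact_Icc.uniformContinuousOn_of_continuous hf.continuousOn
    rw [Metric.uniformContinuousOn_iff] at huc
    obtain ⟨η, hη, hηf⟩ := huc (ε / (T + 1)) (by positivity)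
    have hh0 : ∀ᶠ i in l, 0 < h i :=
      (hh.eventually (self_mem_nhdsWithin : Ioi (0 : ℝ) ∈ 𝓝[>] (0 : ℝ))).mono fun i hi => hi
    have hhη : ∀ᶠ i in l, h i < η :=
      (hh.mono_right nhdsWithin_le_nhds).eventually (gt_mem_nhds hη)
    have hNh1 : ∀ᶠ i in l, (N i : ℝ) * h i < T + 1 := hNh.eventually (gt_mem_nhds (by linarith))
    filter_upwards [hh0, hhη, hNh1] with i hi0 hiη hi1
    rw [Real.dist_eq, sub_zero]
    have hNh0 : 0 ≤ (N i : ℝ) * h i := by positivity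
    -- rewrite both terms as sums of integrals over the cells
    have hcell : ∀ m : ℕ, h i * f (m * h i) = ∫ _ in ((m : ℝ) * h i)..((m + 1 : ℕ) * h i), f (m * h i) := by
      intro m
      rw [intervalIntegral.integral_const, smul_eq_mul]
      push_cast
      ring
    have hsum : ∫ s in (0 : ℝ)..((N i : ℝ) * h i), f s =
        ∑ m ∈ range (N i), ∫ s in ((m : ℝ) * h i)..((m + 1 : ℕ) * h i), f s := by
      rw [intervalIntegral.sum_integral_adjacent_intervals fun k _ => hint _ _]
      simp
    rw [Finset.mul_sum, hsum, ← Finset.sum_sub_distrib]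
    have hterm : ∀ m < N i, |h i * f (m * h i) - ∫ s in ((m : ℝ) * h i)..((m + 1 : ℕ) * h i), f s| ≤
        ε / (T + 1) * h i := by
      intro m hm
      rw [hcell, ← intervalIntegral.integral_sub intervalIntegrable_const (hint _ _)]
      have hle : ((m : ℝ) * h i) ≤ ((m + 1 : ℕ) : ℝ) * h i := by
        push_cast; nlinarith
      have hb := intervalIntegral.norm_integral_le_of_norm_le_const (a := (m : ℝ) * h i)
        (b := ((m + 1 : ℕ) : ℝ) * h i) (f := fun s => f (m * h i) - f s) (C := ε / (T + 1)) ?_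
      · rw [Real.norm_eq_abs] at hb
        refine hb.trans (le_of_eq ?_)
        rw [abs_of_nonneg (by linarith)]
        push_cast; ring
      · intro s hs
        rw [Set.uIoc_of_le hle] at hs
        rw [Real.norm_eq_abs, ← Real.dist_eq]
        have hmT : (m : ℝ) * h i ≤ T + 1 := by
          have : ((m : ℝ) + 1) * h i ≤ (N i : ℝ) * h i := by
            apply mul_le_mul_of_nonneg_right _ hi0.le
            exact_mod_cast Nat.succ_le_of_lt hm
          nlinarith
        have hm0 : 0 ≤ (m : ℝ) * h i := by positivity
        have hs1 : s ≤ T + 1 := by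
          have : ((m + 1 : ℕ) : ℝ) * h i ≤ (N i : ℝ) * h i := by
            apply mul_le_mul_of_nonneg_right _ hi0.le
            exact_mod_cast Nat.succ_le_of_lt hm
          linarith [hs.2]
        refine (hηf _ ⟨hm0, hmT⟩ _ ⟨hm0.trans hs.1.le, hs1⟩ ?_).le
        rw [Real.dist_eq, abs_sub_comm, abs_of_nonneg (by linarith [hs.1])]
        have : s - m * h i ≤ h i := by
          have := hs.2; push_cast at this; linarith
        linarith
    calc |∑ m ∈ range (N i), (h i * f (m * h i) - ∫ s in ((m : ℝ) * h i)..((m + 1 : ℕ) * h i), f s)|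
        ≤ ∑ m ∈ range (N i), |h i * f (m * h i) - ∫ s in ((m : ℝ) * h i)..((m + 1 : ℕ) * h i), f s| :=
          Finset.abs_sum_le_sum_abs _ _
      _ ≤ ∑ _m ∈ range (N i), ε / (T + 1) * h i :=
          Finset.sum_le_sum fun m hm => hterm m (Finset.mem_range.1 hm)
      _ = (N i : ℝ) * h i * (ε / (T + 1)) := by
          rw [Finset.sum_const, Finset.card_range, nsmul_eq_mul]; ring
      _ < (T + 1) * (ε / (T + 1)) := by
          apply mul_lt_mul_of_pos_right hi1; positivity
      _ = ε := by field_simp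
  have := hdiff.add hprim
  simp only [zero_add, sub_add_cancel] at this
  exact this

end Literature.Analysis.Asymptotics
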